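import Summits.QuantumFields.YangMills.Theorems.BalabanUVNodesN16Thm4Assembly
import Summits.QuantumFields.BalabanUV.T4Continuum.Spine.NE3.PairReg335B8
import HarnessLib

/-!
# Route «BalabanUVNodes» (cluster K4 «SpineRates»), Track-A DAG node N16 = NE3 — THE ASSEMBLY WITH (1.33)'s SECOND CLAUSE DISCHARGED:
# file 3's `pairLandauGaugeB8Avg_of_thm4At` with `Reg k := B8Eq133Hypotheses.Reg335Zd (Lᵏ)⁻¹ L (𝒬 k) C` and NO background-regularity binder,
# by n16-b's `PairReg335B8.reg335Zd_rescale_bavg` ([B9] (3.35) at `W = rescale L (bavg L U_B)` from the (H3ˢᵘᵖ) letters); the `d = 4` record knit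

Cell `pub-ymgap`, seat `pub-ymgap-dag-n16-a` (KNIT-BY-NAME, HUMAN RULING D-0062; chair R424 venue), generation 3, file 4.  `bears_on: R4∕N16`.  Filed
`--supports stmt-QuantumFields-19182` (`SpineGivenEndpoint`, K4).  Consumes n16-b g2's F1∕F2 (p417941 `B9Eq335AxialCriterion`, p418431 `PairReg335B8`) BY NAME
the hour they landed (bus [DAGN16B-G2-LANDED-1 + FILED-2] l.10618, [DAGN16A-G3-LANDED-3]).

WHAT.  In file 3 (`BalabanUVNodesN16Thm4Assembly`, p418529) the N05 side of N16's knit is (T4) «[Balaban1985RegularSpaces] Thm 4's typed interface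
`Thm4At L k (Lᵏ)⁻¹ c₁ unitaryUnits (a k) (M k) (ρ k) (Reg k) (Restr129 L k (Λ k)) (Concl k)` at every level» ∧ (REG) «`Reg k W` at every pair background» ∧ (DICT)
«the Concl-dictionary» (+ N07's (H3ˢᵘᵖ)).  With the regularity clause READ AS PRINTED — (1.33) p. 82 second clause «U₀ satisfies the regularity condition
(3.35) in [4]», typed `B8Eq133Hypotheses.Reg335Zd η L 𝒬 C U₀` ([Balaban1985BackgroundPropagators] (3.35) p. 396: on every cube `□ ∈ 𝒬` of level `j`, in some
axial gauge, `|η A| ≤ C·(Lʲη)` bondwise) over an indexed cube family `𝒬 k` of `ℓ¹`-radius `≤ Mc·Lʲ`, levels `j ≤ k` — (REG) is a THEOREM from the (H3ˢᵘᵖ)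
letters: n16-b's `reg335Zd_rescale_bavg` (elementary sufficient criterion `B9Eq335AxialCriterion.reg335Zd_of_plaq_radii` in the complete axial gauge; NOT
print's road via Prop 6).  §1 `pairLandauGaugeB8Avg_of_thm4At_reg335`: file 3 §1 with `Reg k := Reg335Zd (Lᵏ)⁻¹ L (𝒬 k) C`, the binder `hReg` GONE, three
ε-free letter lines added (`(Mc+1)(b′ + 226(8(d+1)(d+4))²b′²) ≤ ½`, the family's radii, `C` above the displayed threshold).  §2 `n16_of_thm4At_reg335` (`d = 4`):
the record knit with the constant of record — (T4)[Reg335] ∧ (DICT) ∧ (H3ˢᵘᵖ) ⟹ N16; after it the ONLY non-printed-type binder on the N05 side besides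
`Thm4At` itself is (DICT) (n16-b's F3 `PairLeftChartB8`, in progress).

HONEST FRAMING.  Bookkeeping over LANDED theorems by name; (T4) = [Balaban1985RegularSpaces] Thm 4 TYPE at curved backgrounds — NOT proved anywhere in the
tree; (DICT), (H3ˢᵘᵖ) binders; **N16 ∕ NE3 is NOT discharged**; NODE 00 has not pinned NE3's carriers; count-neutral; one finite four-torus at fixed ε —
NOT ℝ⁴, NOT infinite volume, NOT OS, NOT a mass gap, NOT Clay.
-/

set_option autoImplicit false

open scoped BigOperators Matrix Matrix.Norms.L2Operator
open NormedSpace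

namespace Summit.QuantumFields.YangMills.BalabanUVNodes.N16

open Literature.MathematicalPhysics.QuantumFieldTheory.Balaban1983to89
open B7Prop1Explicit B7Prop2Explicit
open T4AveragingDeficitWall (vary)
open B8Lemma1NonAbelian (pert)
open B8Eq119TwistedAxial (Thm4At Restr129)
open B8Eq166ConstraintPair (ptw)
open B8Eq133Hypotheses (Reg335Zd)
open Summit.QuantumFields.BalabanUV.T4Continuum
open MinimalActionSandwich (IsMinimiser)
open MinimalActionRate (Regular sfClass)
open MinimalActionRefine (RegularSup)
open BlockAverageCurrent (curConst curConst_nonneg)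
open NE3EnergyWeightedCovShape (NE3EnergyRateWCov)
open NE3RightInverseSupLetters (frameC)
open NE3.PairLandauB8 (LandauRepB8)
open NE3.PairLandauB8Avg (PairLandauGaugeB8Avg)
open NE3.LeafIndexSockets (LeafH3sup)
open NE3.PairReg335B8 (reg335Zd_rescale_bavg)

noncomputable section

variable {d : ℕ} {n : Type*} [Fintype n] [DecidableEq n]

/-! ## §1 The assembly with the regularity clause read as (3.35) and discharged -/

/-- **`PairLandauGaugeB8Avg` ASSEMBLED FROM [B8] THM 4's TYPED INTERFACE WITH `Reg := Reg335Zd`, NO BACKGROUND-REGULARITY BINDER** (`d ≥ 1`, `L ≥ 2`;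
letters as in file 3 §1, plus: `Mc ≥ 0` with `(Mc+1)(b′ + 226(8(d+1)(d+4))²b′²) ≤ ½`; per level `k` an indexed cube family `𝒬 k` of pairs `(□, j)`, `j ≤ k`, each `□`
inside an `ℓ¹`-ball of radius `Mc·Lʲ`; a constant `C > 2(Mc+1)(b′ + …) + 2Mc·2(c′ + curConst·b′²) + 4Mc(1+2Mc)(b′ + …)²`).  (T4) at `Reg k := Reg335Zd (Lᵏ)⁻¹ L (𝒬 k) C`
∧ (DICT) ∧ (H3ˢᵘᵖ) ⟹ `PairLandauGaugeB8Avg d (sfClass d L N ε) L N b g s₁ s₂ β dom` — file 3's `pairLandauGaugeB8Avg_of_thm4At` with `hReg` supplied by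
n16-b's `reg335Zd_rescale_bavg` from `RegularSup d L N b′ c′ (k+1) U_B` (= (H3ˢᵘᵖ) at the pair). [folklore] -/
theorem pairLandauGaugeB8Avg_of_thm4At_reg335 [Nonempty n] (hd : 1 ≤ d) {L N : ℕ} (hL : 2 ≤ L) {ε b g b' c' α c₁ s₁ s₂ β : ℝ}
    (hε : 0 ≤ ε) (hb : 0 ≤ b) (hbs : 512 * (d + 1) * (d + 4) * (L : ℝ) ^ 2 * b ≤ 1)
    (hbα : b + 226 * (8 * (d + 1) * (d + 4)) ^ 2 * b ^ 2 < α)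
    (hb' : 0 ≤ b') (hc' : 0 ≤ c') (hb'1 : b' ≤ 1) (hRb : 2 ^ 15 * ((d : ℝ) + 1) ^ 2 * ((d : ℝ) + 4) ^ 2 * (L : ℝ) ^ 2 * b' ≤ 1)
    (hb'α : b' + 226 * (8 * (d + 1) * (d + 4)) ^ 2 * b' ^ 2 < α) (hc'α : 4 * ((d : ℝ) - 1) * (c' + curConst d L * b' ^ 2) < α)
    (hα : 0 < α) (hεα : ε < α) (hα3 : C0 d * α ≤ 1 / 3) (hα2 : 2 * α ≤ c2' d L) (hsmall : 11 * (d : ℝ) ^ 2 * α ≤ 1 / 6)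
    (hc₁ : α + 11 * (d : ℝ) ^ 2 * α ≤ c₁)
    {Mc : ℝ} (hMc : 0 ≤ Mc) (hMcα : (Mc + 1) * (b' + 226 * (8 * (d + 1) * (d + 4)) ^ 2 * b' ^ 2) ≤ 1 / 2)
    {𝒬 : ℕ → Set (Set (Site d) × ℕ)}
    (h𝒬 : ∀ k, ∀ q ∈ 𝒬 k, q.2 ≤ k ∧ ∃ y : Site d, ∀ z ∈ q.1, (l1 (z - y) : ℝ) ≤ Mc * (L : ℝ) ^ q.2)
    {C : ℝ} (hC : 2 * (Mc + 1) * (b' + 226 * (8 * (d + 1) * (d + 4)) ^ 2 * b' ^ 2) + 2 * Mc * (2 * (c' + curConst d L * b' ^ 2)) +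
      4 * Mc * (1 + 2 * Mc) * (b' + 226 * (8 * (d + 1) * (d + 4)) ^ 2 * b' ^ 2) ^ 2 < C)
    {a : ℕ → Site d} {M ρ : ℕ → ℕ} {Λ : ℕ → ℕ → Set (Site d)}
    {Concl : ℕ → ℝ → ℝ → (Site d → Fin d → (Matrix n n ℂ)ˣ) → (Site d → Fin d → (Matrix n n ℂ)ˣ) → (Site d → (Matrix n n ℂ)ˣ) → Prop}
    (hΛ : ∀ k, Λ k k = Set.univ)
    (hT4 : ∀ k, 1 ≤ k → Thm4At L k (((L : ℝ) ^ k)⁻¹) c₁ (unitaryUnits (Matrix n n ℂ)) (a k) (M k) (ρ k)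
      (Reg335Zd (((L : ℝ) ^ k)⁻¹) L (𝒬 k) C) (Restr129 L k (Λ k)) (Concl k))
    {dom : Set (Site d → Fin d → (Matrix n n ℂ)ˣ)}
    (hdict : ∀ k : ℕ, 1 ≤ k → ∀ V ∈ dom, ∀ UA UB : Site d → Fin d → (Matrix n n ℂ)ˣ,
      IsMinimiser d (sfClass d L N ε) L N k V UA → IsMinimiser d (sfClass d L N ε) L N (k + 1) V UB →
      ∀ u : Site d → (Matrix n n ℂ)ˣ, (∀ x, u x ∈ unitaryUnits (Matrix n n ℂ)) →
        Concl k α (11 * (d : ℝ) ^ 2 * α) (rescale L (bavg L UB))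
          (pert (gaugeAct (ptw L (rescale L (bavg L UB)) UA k) UA) (rescale L (bavg L UB))) u →
        ∃ (uL : Site d → (Matrix n n ℂ)ˣ) (Z : Site d → Fin d → Matrix n n ℂ),
          LandauRepB8 L N k (rescale L (bavg L UB)) UA uL Z s₁ s₂ β ∧
          gaugeAct u (vary (rescale L (bavg L UB)) Z 1) = gaugeAct (ptw L (rescale L (bavg L UB)) UA k) UA)
    (h3 : LeafH3sup d L N ε b' c' dom) :
    PairLandauGaugeB8Avg d (sfClass d L N ε) L N b g s₁ s₂ β dom := by
  have hL1 : 1 ≤ L := by omega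
  refine pairLandauGaugeB8Avg_of_thm4At hd hL hε hb hbs hbα hb' hc' hb'1 hRb hb'α hc'α hα hεα hα3 hα2 hsmall hc₁
    (Reg := fun k => Reg335Zd (((L : ℝ) ^ k)⁻¹) L (𝒬 k) C) hΛ hT4 (fun k hk V hV UA UB _ hB => ?_) hdict h3
  -- (REG) from (H3ˢᵘᵖ): `U_B` is `RegularSup b′ c′` at level `k + 1`
  exact reg335Zd_rescale_bavg hL1 (h3 V hV k UB hB) hb' hc' hRb hMc hMcα (h𝒬 k) hC

/-! ## §2 The `d = 4` record knit with the regularity clause discharged -/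

/-- **N16 · NE3 BY NAME FROM [B8] THM 4's TYPED INTERFACE (`Reg := Reg335Zd`), ITS CONCL-DICTIONARY, AND N07's INTERFACE** (`d = 4`; `L ≥ 2`, `N ≥ 1`;
Thm 4's constant `c₁ > 0`; `α⋆ = min {1∕(3C₀(4)), c₂′(4,L)∕2, 1∕1056, c₁∕177}` as in file 3): `∃ r > 0, ∀ g > 0, ∃ C ≥ 0, ∀ b′ c′` on the four ε-free leaf lines of
file 3, `∀ Mc ≥ 0` with `(Mc+1)(b′ + 226·320²·b′²) ≤ ½`, every cube-family radius-`Mc` system `𝒬`, every `C₃₃₅` above the displayed threshold, `∀ 0 < ε ≤ r,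
0 ≤ s₁ ≤ r, 0 ≤ b ≤ ε∕2, ∀ s₂`, families `(a, M, ρ, Λ, Concl)` with `Λ k k = univ`, `dom`: (T4) at `Reg k := Reg335Zd (Lᵏ)⁻¹ L (𝒬 k) C₃₃₅` → (DICT) at `α⋆` →
`LeafH3sup 4 L N ε b′ c′ dom` → `NE3EnergyRateWCov 4 (sfClass 4 L N ε) L N b g C s₁ s₂ dom` — file 3's `n16_of_thm4At` with (REG) supplied by §1's source.
The N05 side's binders are now (T4) — Theorem 4 TYPE, N05's node — and (DICT) only.  N16 ∕ NE3 NOT proved. [folklore] -/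
theorem n16_of_thm4At_reg335 [Nonempty n] {L N : ℕ} (hL : 2 ≤ L) (hN : 1 ≤ N) {c₁ : ℝ} (hc₁ : 0 < c₁) :
    ∃ r : ℝ, 0 < r ∧ ∀ ⦃g : ℝ⦄, 0 < g → ∃ C : ℝ, 0 ≤ C ∧ ∀ ⦃b' c' : ℝ⦄, 0 ≤ b' → 0 ≤ c' →
      2 ^ 15 * ((4 : ℝ) + 1) ^ 2 * ((4 : ℝ) + 4) ^ 2 * (L : ℝ) ^ 2 * b' ≤ 1 →
      23040 * (4 : ℝ) ^ 4 * (frameC 4 L + 4) ^ 3 * (c' + curConst 4 L * b' ^ 2) ≤ 1 →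
      b' + 226 * (8 * ((4 : ℝ) + 1) * ((4 : ℝ) + 4)) ^ 2 * b' ^ 2 < min (1 / (3 * C0 4)) (min (c2' 4 L / 2) (min (1 / 1056) (c₁ / 177))) →
      4 * ((4 : ℝ) - 1) * (c' + curConst 4 L * b' ^ 2) < min (1 / (3 * C0 4)) (min (c2' 4 L / 2) (min (1 / 1056) (c₁ / 177))) →
      ∀ ⦃Mc : ℝ⦄, 0 ≤ Mc → (Mc + 1) * (b' + 226 * (8 * ((4 : ℝ) + 1) * ((4 : ℝ) + 4)) ^ 2 * b' ^ 2) ≤ 1 / 2 →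
      ∀ (𝒬 : ℕ → Set (Set (Site 4) × ℕ)), (∀ k, ∀ q ∈ 𝒬 k, q.2 ≤ k ∧ ∃ y : Site 4, ∀ z ∈ q.1, (l1 (z - y) : ℝ) ≤ Mc * (L : ℝ) ^ q.2) →
      ∀ ⦃C335 : ℝ⦄, 2 * (Mc + 1) * (b' + 226 * (8 * ((4 : ℝ) + 1) * ((4 : ℝ) + 4)) ^ 2 * b' ^ 2) + 2 * Mc * (2 * (c' + curConst 4 L * b' ^ 2)) +
        4 * Mc * (1 + 2 * Mc) * (b' + 226 * (8 * ((4 : ℝ) + 1) * ((4 : ℝ) + 4)) ^ 2 * b' ^ 2) ^ 2 < C335 →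
      ∀ ⦃ε s₁ b : ℝ⦄, 0 < ε → ε ≤ r → 0 ≤ s₁ → s₁ ≤ r → 0 ≤ b → b ≤ ε / 2 → ∀ (s₂ : ℝ)
      (a : ℕ → Site 4) (M ρ : ℕ → ℕ) (Λ : ℕ → ℕ → Set (Site 4))
      (Concl : ℕ → ℝ → ℝ → (Site 4 → Fin 4 → (Matrix n n ℂ)ˣ) → (Site 4 → Fin 4 → (Matrix n n ℂ)ˣ) → (Site 4 → (Matrix n n ℂ)ˣ) → Prop),
      (∀ k, Λ k k = Set.univ) →
      (∀ k, 1 ≤ k → Thm4At L k (((L : ℝ) ^ k)⁻¹) c₁ (unitaryUnits (Matrix n n ℂ)) (a k) (M k) (ρ k)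
        (Reg335Zd (((L : ℝ) ^ k)⁻¹) L (𝒬 k) C335) (Restr129 L k (Λ k)) (Concl k)) →
      ∀ {dom : _root_.Set (Site 4 → Fin 4 → (Matrix n n ℂ)ˣ)},
        (∀ k : ℕ, 1 ≤ k → ∀ V ∈ dom, ∀ UA UB : Site 4 → Fin 4 → (Matrix n n ℂ)ˣ,
          IsMinimiser 4 (sfClass 4 L N ε) L N k V UA → IsMinimiser 4 (sfClass 4 L N ε) L N (k + 1) V UB →
          ∀ u : Site 4 → (Matrix n n ℂ)ˣ, (∀ x, u x ∈ unitaryUnits (Matrix n n ℂ)) →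
            Concl k (min (1 / (3 * C0 4)) (min (c2' 4 L / 2) (min (1 / 1056) (c₁ / 177))))
              (11 * ((4 : ℕ) : ℝ) ^ 2 * min (1 / (3 * C0 4)) (min (c2' 4 L / 2) (min (1 / 1056) (c₁ / 177))))
              (rescale L (bavg L UB)) (pert (gaugeAct (ptw L (rescale L (bavg L UB)) UA k) UA) (rescale L (bavg L UB))) u →
            ∃ (uL : Site 4 → (Matrix n n ℂ)ˣ) (Z : Site 4 → Fin 4 → Matrix n n ℂ),
              LandauRepB8 L N k (rescale L (bavg L UB)) UA uL Z s₁ s₂ 1 ∧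
              gaugeAct u (vary (rescale L (bavg L UB)) Z 1) = gaugeAct (ptw L (rescale L (bavg L UB)) UA k) UA) →
        LeafH3sup 4 L N ε b' c' dom →
        NE3EnergyRateWCov 4 (sfClass 4 L N ε) L N b g C s₁ s₂ dom := by
  have hL1 : 1 ≤ L := by omega
  obtain ⟨r, hr0, hr⟩ := n16_of_thm4At (n := n) hL hN hc₁
  refine ⟨r, hr0, fun g hg => ?_⟩
  obtain ⟨C, hC0, hC⟩ := hr hg
  refine ⟨C, hC0, fun b' c' hb' hc' hRb hcF hb'α hc'α Mc hMc hMcα 𝒬 h𝒬 C335 hC335 ε s₁ b hε hεr hs₁ hs₁r hb hbh s₂ a M ρ Λ Concl hΛ hT4 dom hdict h3 => ?_⟩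
  refine hC hb' hc' hRb hcF hb'α hc'α hε hεr hs₁ hs₁r hb hbh s₂ a M ρ (fun k => Reg335Zd (((L : ℝ) ^ k)⁻¹) L (𝒬 k) C335) Λ Concl hΛ hT4
    (fun k hk V hV UA UB _ hB => ?_) hdict h3
  -- (REG) from (H3ˢᵘᵖ) at `d = 4`
  have hRb' : 2 ^ 15 * ((((4 : ℕ) : ℝ)) + 1) ^ 2 * ((((4 : ℕ) : ℝ)) + 4) ^ 2 * (L : ℝ) ^ 2 * b' ≤ 1 := by simpa only [Nat.cast_ofNat] using hRb
  have hMcα' : (Mc + 1) * (b' + 226 * (8 * ((4 : ℕ) + 1 : ℝ) * ((4 : ℕ) + 4 : ℝ)) ^ 2 * b' ^ 2) ≤ 1 / 2 := by simpa using hMcα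
  have hC335' : 2 * (Mc + 1) * (b' + 226 * (8 * ((4 : ℕ) + 1 : ℝ) * ((4 : ℕ) + 4 : ℝ)) ^ 2 * b' ^ 2) + 2 * Mc * (2 * (c' + curConst 4 L * b' ^ 2)) +
      4 * Mc * (1 + 2 * Mc) * (b' + 226 * (8 * ((4 : ℕ) + 1 : ℝ) * ((4 : ℕ) + 4 : ℝ)) ^ 2 * b' ^ 2) ^ 2 < C335 := by simpa using hC335
  exact reg335Zd_rescale_bavg hL1 (h3 V hV k UB hB) hb' hc' hRb' hMc hMcα' (h𝒬 k) hC335'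

end

end Summit.QuantumFields.YangMills.BalabanUVNodes.N16
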